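import Summits.QuantumFields.YangMills.Theorems.BalabanUVNodesN19LawPriceAtSchemeRate

/-!
# YM-DAG node N19 (= NE7 proper) — THE LAW-LEVEL PRICE, at events: distribution functions match up to a LÉVY smearing `h` at cost `(1+1∕h)·log(e+L)∕(1+L)`

Cell `pub-ymgap`, HUMAN RULING D-0062 (Track A), R141 (C) wider-strategy seat `pub-ymgap-dag-n19-e` (strategy s3 = ALTERNATIVE CURRENCY), generation
g18, module 8.  Route `Summits/QuantumFields/YangMills/Theses/BalabanUVNodes.lean` rev 25, cluster item K3⁷ «SpineGivenEndpointR13SepCoPH»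
(stmt-QuantumFields-20544, dag-lead WORDS-143); filed `--supports` that item `--as helper` (it proves no registered stub).  COUNT-NEUTRAL: bookkeeping over the
seat's p556871 `…N19LawPriceAtSchemeRate` (`law_price_le_logRate_of_nonneg`) and p551618 `…N19LawPriceAtScheme` (`map_prodObs_Icc_compl`, `cgf_map_prodObs`) BY
NAME, with Mathlib's `LipschitzWith.max_const` ∕ `min_const`, `integral_indicator_one`; `Spine.NE7.Target` a HYPOTHESIS; no Theses import; NOT a discharge claim.

THE RESULT.  What the law currency buys for PROBABILITIES OF EVENTS.  By p557300 `kolmogorov_not_controlled` distribution functions are NOT controlled at a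
point (`δ₀` vs `δ_η`); they ARE controlled up to a Lévy smearing: for laws `μ, ν` on `[−1,1]` with cgf's `ε`-close on `|t| ≤ l₀` (`0 ≤ ε ≤ 1`), every level
`a` and every `h > 0`,
★★ `cdf_le_cdf_add_of_cgf_close` — `μ(−∞,a] ≤ ν(−∞,a+h] + 384·c(l₀)·(1∕h + 1)·log(e+L)∕(1+L)` (and symmetrically with `μ, ν` exchanged) — the ramp
`x ↦ min(1, max(0, (a+h−x)∕h))` is `(1∕h)`-Lipschitz, `[0,1]`-valued, `1` on `(−∞,a]`, `0` on `[a+h,∞)` (§1), priced by p556871.  So the LÉVY distance of the two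
laws is `≲ √(c(l₀)·log(e+L)∕(1+L))` (take `h = √rate`; not typed as a metric).  At the scheme (§3), under `Spine.NE7.Target` with `τ_K ≤ 1` and `ν` the continuum
law of `∏os`: ★★ `prob_prodObs_le_le_of_target` ∕ `cdf_continuumLaw_le_prob_prodObs_of_target` — `P_K(∏os ≤ a) ≤ ν(−∞,a+h] + C·(1∕h+1)·rate(τ_K)` and
`ν(−∞,a−h] − C·(1∕h+1)·rate(τ_K) ≤ P_K(∏os ≤ a)`: the lattice probabilities of `{∏os ≤ a}` converge to the continuum ones at every continuity level `a` of
`ν`, quantitatively.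

HONEST FRAMING (binding).  Bookkeeping ∕ [folklore]; NO consumer in the DAG today.  `Target` is a HYPOTHESIS; nothing of Bałaban's is instantiated; N19 NOT
discharged; count-neutral.  One finite `T⁴` programme at fixed `ε`; nothing continuum ∕ `ℝ⁴` ∕ OS ∕ mass-gap ∕ Clay.  0 `def` ∕ 0 `sorry`.
-/

noncomputable section

open Set Filter Topology Real MeasureTheory ProbabilityTheory

namespace Summit.QuantumFields.YangMills.Theorems.BalabanUVNodesN19LawPriceLevy

open Literature.MathematicalPhysics.QuantumFieldTheory.Balaban1983to89
open T4CauchySum (MatchingModConstants genFun genFunLim abs_genFun_sub_lim_le)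
open T4GenFunBounds (schemeZ prodObs gibbsMeasure)
open Missing (TorusScheme)
open Summit.QuantumFields.BalabanUV.T4Continuum.Spine
open Summit.QuantumFields.YangMills.BalabanUVNodes.N19ExpectationCurrencyAtScheme (mul_nonneg_of_matchingModConstants)
open Summit.QuantumFields.YangMills.BalabanUVNodes.N19ContinuumLawAtScheme (genFunLim_eq_cgf_of_continuumLaw)
open Summit.QuantumFields.YangMills.Theorems.BalabanUVNodesN19LawPriceAtScheme (map_prodObs_Icc_compl cgf_map_prodObs)
open Summit.QuantumFields.YangMills.Theorems.BalabanUVNodesN19LawPriceJackson (integrable_of_continuous_Icc_symm)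
open Summit.QuantumFields.YangMills.Theorems.BalabanUVNodesN19LawPriceAtSchemeRate (law_price_le_logRate_of_nonneg)

/-! ## §1 The ramp test function `x ↦ min(1, max(0, (a + h − x)∕h))` -/

/-- The ramp is `(1∕h)`-Lipschitz. [folklore] -/
theorem lipschitzWith_ramp (a : ℝ) {h : ℝ} (hh : 0 < h) :
    LipschitzWith (Real.toNNReal h⁻¹) (fun x : ℝ => min 1 (max 0 ((a + h - x) / h))) := by
  have hlin : LipschitzWith (Real.toNNReal h⁻¹) (fun x : ℝ => (a + h - x) / h) :=
    LipschitzWith.of_dist_le_mul fun x y => by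
      rw [Real.dist_eq, Real.dist_eq, Real.coe_toNNReal _ (inv_pos.2 hh).le, ← sub_div, abs_div, abs_of_pos hh,
        show a + h - x - (a + h - y) = -(x - y) by ring, abs_neg, div_eq_inv_mul]
  exact (hlin.const_max 0).const_min 1

/-- The ramp is continuous. [folklore] -/
theorem continuous_ramp (a h : ℝ) : Continuous (fun x : ℝ => min 1 (max 0 ((a + h - x) / h))) := by
  fun_prop

/-- The ramp is `[0,1]`-valued. [folklore] -/
theorem ramp_mem_Icc (a h x : ℝ) : min 1 (max 0 ((a + h - x) / h)) ∈ Icc (0 : ℝ) 1 :=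
  ⟨le_min zero_le_one (le_max_left _ _), min_le_left _ _⟩

/-- The ramp dominates the indicator of `(−∞, a]` (`0 < h`). [folklore] -/
theorem indicator_Iic_le_ramp (a : ℝ) {h : ℝ} (hh : 0 < h) (x : ℝ) :
    (Iic a).indicator (1 : ℝ → ℝ) x ≤ min 1 (max 0 ((a + h - x) / h)) := by
  by_cases hx : x ∈ Iic a
  · rw [indicator_of_mem hx, Pi.one_apply]
    refine le_min le_rfl (le_trans ?_ (le_max_right _ _))
    rw [le_div_iff₀ hh, one_mul]
    have := mem_Iic.1 hx
    linarith
  · rw [indicator_of_notMem hx]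
    exact (ramp_mem_Icc a h x).1

/-- The ramp is dominated by the indicator of `(−∞, a + h]` (`0 < h`). [folklore] -/
theorem ramp_le_indicator_Iic (a : ℝ) {h : ℝ} (hh : 0 < h) (x : ℝ) :
    min 1 (max 0 ((a + h - x) / h)) ≤ (Iic (a + h)).indicator (1 : ℝ → ℝ) x := by
  by_cases hx : x ∈ Iic (a + h)
  · rw [indicator_of_mem hx, Pi.one_apply]
    exact min_le_left _ _
  · rw [indicator_of_notMem hx]
    have hx' : a + h < x := not_le.1 (fun h' => hx (mem_Iic.2 h'))
    refine min_le_of_right_le (max_le le_rfl ?_)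
    rw [div_nonpos_iff]
    exact Or.inr ⟨by linarith, hh.le⟩

/-! ## §2 Distribution functions of laws on `[−1,1]` whose cgf's match on a window -/

section Laws

variable {μ ν : Measure ℝ} [IsProbabilityMeasure μ] [IsProbabilityMeasure ν]

/-- **★★ DISTRIBUTION FUNCTIONS MATCH UP TO A LÉVY SMEARING.**  Laws `μ, ν` on `[−1,1]`, cgf's `ε`-close on `|t| ≤ l₀` (`0 < l₀`, `0 ≤ ε ≤ 1`): for every
level `a` and every `h > 0`, `μ(−∞,a] ≤ ν(−∞,a+h] + 384·c(l₀)·(h⁻¹ + 1)·log(e+L)∕(1+L)`, `L = log⁺ε⁻¹`, `c(l₀) = 6 + l₀ + log max(1,4e∕l₀)` — the ramp of §1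
between the two indicators, priced by p556871 `law_price_le_logRate_of_nonneg` (`K = h⁻¹`, `G = 1`).  By symmetry the same with `μ, ν` exchanged; `h → 0` is
impossible (p557300 `kolmogorov_not_controlled`). [folklore] -/
theorem cdf_le_cdf_add_of_cgf_close (hμ : μ (Icc (-1) 1)ᶜ = 0) (hν : ν (Icc (-1) 1)ᶜ = 0) {ε l₀ : ℝ} (hl₀ : 0 < l₀)
    (hε : 0 ≤ ε) (hε1 : ε ≤ 1) (hclose : ∀ t : ℝ, |t| ≤ l₀ → |cgf id ν t - cgf id μ t| ≤ ε) (a : ℝ) {h : ℝ} (hh : 0 < h) :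
    μ.real (Iic a) ≤ ν.real (Iic (a + h)) +
      384 * (6 + l₀ + Real.log (max 1 (4 * Real.exp 1 / l₀))) * (h⁻¹ + 1) *
        (Real.log (Real.exp 1 + Real.posLog ε⁻¹) / (1 + Real.posLog ε⁻¹)) := by
  set r : ℝ → ℝ := fun x => min 1 (max 0 ((a + h - x) / h)) with hr
  have hG : ∀ x ∈ Icc (-1 : ℝ) 1, |r x| ≤ 1 := fun x _ => by
    rw [abs_of_nonneg (ramp_mem_Icc a h x).1]; exact (ramp_mem_Icc a h x).2
  have hprice := law_price_le_logRate_of_nonneg hμ hν hl₀ hε hε1 hclose (lipschitzWith_ramp a hh) hG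
  rw [Real.coe_toNNReal _ (inv_pos.2 hh).le] at hprice
  have hIr : ∀ (κ : Measure ℝ) [IsProbabilityMeasure κ], κ (Icc (-1) 1)ᶜ = 0 → Integrable r κ := fun κ _ hκ =>
    integrable_of_continuous_Icc_symm hκ (continuous_ramp a h)
  -- `μ(−∞,a] ≤ ∫ r dμ`
  have h1 : μ.real (Iic a) ≤ ∫ x, r x ∂μ := by
    rw [← integral_indicator_one measurableSet_Iic]
    exact integral_mono ((integrable_const (1 : ℝ)).indicator measurableSet_Iic) (hIr μ hμ) fun x => indicator_Iic_le_ramp a hh x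
  -- `∫ r dν ≤ ν(−∞,a+h]`
  have h2 : ∫ x, r x ∂ν ≤ ν.real (Iic (a + h)) := by
    rw [← integral_indicator_one measurableSet_Iic]
    exact integral_mono (hIr ν hν) ((integrable_const (1 : ℝ)).indicator measurableSet_Iic) fun x => ramp_le_indicator_Iic a hh x
  have h3 : ∫ x, r x ∂μ ≤ ∫ x, r x ∂ν + |∫ x, r x ∂ν - ∫ x, r x ∂μ| := by
    have := neg_abs_le (∫ x, r x ∂ν - ∫ x, r x ∂μ); linarith
  linarith

/-- … and from below: `ν(−∞,a−h] − 384·c(l₀)·(h⁻¹+1)·rate ≤ μ(−∞,a]` (the previous statement with the roles exchanged, at level `a − h`). [folklore] -/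
theorem cdf_sub_le_cdf_of_cgf_close (hμ : μ (Icc (-1) 1)ᶜ = 0) (hν : ν (Icc (-1) 1)ᶜ = 0) {ε l₀ : ℝ} (hl₀ : 0 < l₀)
    (hε : 0 ≤ ε) (hε1 : ε ≤ 1) (hclose : ∀ t : ℝ, |t| ≤ l₀ → |cgf id ν t - cgf id μ t| ≤ ε) (a : ℝ) {h : ℝ} (hh : 0 < h) :
    ν.real (Iic (a - h)) -
      384 * (6 + l₀ + Real.log (max 1 (4 * Real.exp 1 / l₀))) * (h⁻¹ + 1) *
        (Real.log (Real.exp 1 + Real.posLog ε⁻¹) / (1 + Real.posLog ε⁻¹)) ≤ μ.real (Iic a) := by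
  have hclose' : ∀ t : ℝ, |t| ≤ l₀ → |cgf id μ t - cgf id ν t| ≤ ε := fun t ht => by rw [abs_sub_comm]; exact hclose t ht
  have h := cdf_le_cdf_add_of_cgf_close hν hμ hl₀ hε hε1 hclose' (a - h) hh
  rw [sub_add_cancel] at h
  linarith

end Laws

/-! ## §3 At the scheme under `Spine.NE7.Target`: lattice probabilities of `{∏os ≤ a}` vs the continuum law -/

section Scheme

variable {G : Type*} [GaugeGroup G] [MeasurableSpace G] [RegularGaugeGroup G] [HaarData G] {O : Type*}
  (S : TorusScheme G O) (hβ : ∀ K, 0 ≤ S.β K) (hm : ∀ K o, Measurable (S.obs K o))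
  (h1 : ∀ K o U, |S.obs K o U| ≤ 1)
include hβ hm h1

/-- **★★ LATTICE PROBABILITIES OF `{∏os ≤ a}` VS THE CONTINUUM LAW, FROM ABOVE.**  Under `Spine.NE7.Target vol l₀ δ (schemeZ S os)` on `0 < l₀` (HYPOTHESIS),
with `ν` the continuum law of `∏os` (p505344) and `τ_K = ∑_m 2vol·δ_{K+m} ≤ 1`: for every level `a` and `h > 0`,
`gibbs_K{∏os ≤ a} ≤ ν(−∞,a+h] + 384·c(l₀)·(h⁻¹+1)·log(e+L_K)∕(1+L_K)`, `L_K = log⁺τ_K⁻¹`. [bookkeeping] -/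
theorem prob_prodObs_le_le_of_target {vol l₀ : ℝ} {δ : ℕ → ℝ} (hl₀ : 0 < l₀) (os : List O)
    (hT : NE7.Target vol l₀ δ (schemeZ S os)) (ν : Measure ℝ) [IsProbabilityMeasure ν] (hν1 : ν (Icc (-1) 1)ᶜ = 0)
    (hν : ∀ f : ℝ → ℝ, Continuous f →
      Tendsto (fun K => ∫ U, f (prodObs S K os U) ∂gibbsMeasure (S.P K) (S.β K)) atTop (𝓝 (∫ x, f x ∂ν)))
    (K : ℕ) (hτ1 : ∑' m, 2 * (vol * δ (K + m)) ≤ 1) (a : ℝ) {h : ℝ} (hh : 0 < h) :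
    (gibbsMeasure (S.P K) (S.β K)).real {U | prodObs S K os U ≤ a} ≤ ν.real (Iic (a + h)) +
      384 * (6 + l₀ + Real.log (max 1 (4 * Real.exp 1 / l₀))) * (h⁻¹ + 1) *
        (Real.log (Real.exp 1 + Real.posLog (∑' m, 2 * (vol * δ (K + m)))⁻¹) /
          (1 + Real.posLog (∑' m, 2 * (vol * δ (K + m)))⁻¹)) := by
  obtain ⟨hM, hδ⟩ := hT
  haveI hP : IsProbabilityMeasure (gibbsMeasure (G := G) (S.P K) (S.β K)) :=
    T4GenFunBounds.isProbabilityMeasure_gibbsMeasure (G := G) (S.P K) (hβ K)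
  have hmeas := T4GenFunBounds.measurable_prodObs S hm K os
  set μK : Measure ℝ := (gibbsMeasure (S.P K) (S.β K)).map (prodObs S K os) with hμK
  haveI : IsProbabilityMeasure μK := Measure.isProbabilityMeasure_map hmeas.aemeasurable
  have hτ0 : 0 ≤ ∑' m, 2 * (vol * δ (K + m)) :=
    tsum_nonneg fun m => mul_nonneg two_pos.le (mul_nonneg_of_matchingModConstants hl₀.le hM (K + m))
  have hclose : ∀ t : ℝ, |t| ≤ l₀ → |cgf id ν t - cgf id μK t| ≤ ∑' m, 2 * (vol * δ (K + m)) := fun t ht => by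
    rw [hμK, cgf_map_prodObs S hβ hm h1 K os t, ← (genFunLim_eq_cgf_of_continuumLaw S hβ hm h1 os ν hν t).2, abs_sub_comm]
    exact abs_genFun_sub_lim_le hM hl₀.le hδ ht K
  have h := cdf_le_cdf_add_of_cgf_close (μ := μK) (ν := ν) (map_prodObs_Icc_compl S hm h1 K os) hν1 hl₀ hτ0 hτ1 hclose a hh
  have hset : μK.real (Iic a) = (gibbsMeasure (S.P K) (S.β K)).real {U | prodObs S K os U ≤ a} := by
    rw [hμK, measureReal_def, measureReal_def, Measure.map_apply hmeas measurableSet_Iic]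
    rfl
  rwa [hset] at h

/-- **★★ … AND FROM BELOW**: `ν(−∞,a−h] − 384·c(l₀)·(h⁻¹+1)·log(e+L_K)∕(1+L_K) ≤ gibbs_K{∏os ≤ a}`.  Together: at every continuity level `a` of `ν`,
`gibbs_K{∏os ≤ a} → ν(−∞,a]` quantitatively (Lévy smearing `h` against the rate). [bookkeeping] -/
theorem cdf_continuumLaw_le_prob_prodObs_of_target {vol l₀ : ℝ} {δ : ℕ → ℝ} (hl₀ : 0 < l₀) (os : List O)
    (hT : NE7.Target vol l₀ δ (schemeZ S os)) (ν : Measure ℝ) [IsProbabilityMeasure ν] (hν1 : ν (Icc (-1) 1)ᶜ = 0)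
    (hν : ∀ f : ℝ → ℝ, Continuous f →
      Tendsto (fun K => ∫ U, f (prodObs S K os U) ∂gibbsMeasure (S.P K) (S.β K)) atTop (𝓝 (∫ x, f x ∂ν)))
    (K : ℕ) (hτ1 : ∑' m, 2 * (vol * δ (K + m)) ≤ 1) (a : ℝ) {h : ℝ} (hh : 0 < h) :
    ν.real (Iic (a - h)) -
      384 * (6 + l₀ + Real.log (max 1 (4 * Real.exp 1 / l₀))) * (h⁻¹ + 1) *
        (Real.log (Real.exp 1 + Real.posLog (∑' m, 2 * (vol * δ (K + m)))⁻¹) /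
          (1 + Real.posLog (∑' m, 2 * (vol * δ (K + m)))⁻¹)) ≤
      (gibbsMeasure (S.P K) (S.β K)).real {U | prodObs S K os U ≤ a} := by
  obtain ⟨hM, hδ⟩ := hT
  haveI hP : IsProbabilityMeasure (gibbsMeasure (G := G) (S.P K) (S.β K)) :=
    T4GenFunBounds.isProbabilityMeasure_gibbsMeasure (G := G) (S.P K) (hβ K)
  have hmeas := T4GenFunBounds.measurable_prodObs S hm K os
  set μK : Measure ℝ := (gibbsMeasure (S.P K) (S.β K)).map (prodObs S K os) with hμK
  haveI : IsProbabilityMeasure μK := Measure.isProbabilityMeasure_map hmeas.aemeasurable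
  have hτ0 : 0 ≤ ∑' m, 2 * (vol * δ (K + m)) :=
    tsum_nonneg fun m => mul_nonneg two_pos.le (mul_nonneg_of_matchingModConstants hl₀.le hM (K + m))
  have hclose : ∀ t : ℝ, |t| ≤ l₀ → |cgf id ν t - cgf id μK t| ≤ ∑' m, 2 * (vol * δ (K + m)) := fun t ht => by
    rw [hμK, cgf_map_prodObs S hβ hm h1 K os t, ← (genFunLim_eq_cgf_of_continuumLaw S hβ hm h1 os ν hν t).2, abs_sub_comm]
    exact abs_genFun_sub_lim_le hM hl₀.le hδ ht K
  have h := cdf_sub_le_cdf_of_cgf_close (μ := μK) (ν := ν) (map_prodObs_Icc_compl S hm h1 K os) hν1 hl₀ hτ0 hτ1 hclose a hh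
  have hset : μK.real (Iic a) = (gibbsMeasure (S.P K) (S.β K)).real {U | prodObs S K os U ≤ a} := by
    rw [hμK, measureReal_def, measureReal_def, Measure.map_apply hmeas measurableSet_Iic]
    rfl
  rwa [hset] at h

end Scheme

end Summit.QuantumFields.YangMills.Theorems.BalabanUVNodesN19LawPriceLevy

end
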